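/-
Copyright: the b2b-balaban cell (near-miss cell 7), T⁴-continuum fan-out, lineage t4-ne7b-p3 (node U5c LARGE-DEVIATION
member P3).  Released under the licence of the surrounding project.
-/
import Summits.QuantumFields.BalabanUV.T4Continuum.Support.SpaceTimeOccupancy
import Summits.QuantumFields.BalabanUV.T4Continuum.Support.ZoneTransport

/-!
# Space-time Peierls ∕ Cramér route for NE7b — RELABELLING INVARIANCE of the realised-lineage functionals
# (`skel`, `dom`, `occAt`, `SkelOK`, `treeSteps`, `Dfun`, `treeD`, `treeCells`)

Summits-side support leaf of the T⁴-continuum cell (rung (B)+1 on a FINITE torus only; NOT infinite volume, NOT the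
mass gap, NOT the Clay statement; NOT a proof of the spine estimate NE7b).  Lineage `t4-ne7b-p3` (generation 3), node
U5c, skeleton `t4/skeletons/NE7b-t4-ne7b-p3.md` §12 (the junction with the COUNT carrier needs the lineage data
`LinData` with PER-LINEAGE pieces; tagging the events of each lineage by the lineage — the push-forward
`ZoneSkeleton.gmap (Prod.mk λ)` — turns a family of per-lineage piece maps into ONE piece map on the tagged labels, and
every functional of the CONTOUR route is invariant under such a push-forward).  [folklore] finite combinatorics:
structural inductions over the genealogy carrier `T4PersistenceDictionary.Gen` composing this lineage's
`SpaceTimeLifetime` ∕ `SpaceTimeVolume` ∕ `SpaceTimeRealised` ∕ `SpaceTimeRealisedCells` ∕ `SpaceTimeOccupancy` with the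
COUNT swarm's `ZoneSkeleton.gmap` (`ZoneTransport`, p-landed; `events_gmap`), all BY NAME; nothing printed is asserted;
no `[cite:]` tag.

WHAT.  For a map of labels `f : ε → δ` and data `step' ∘ f = step`, `piece' ∘ f = piece`, `fat' ∘ f = fat`
(pointwise), and every genealogy `G : Gen ε`:
* §1 sets: `skel_gmap`, `dom_gmap`, `occAt_gmap` — the skeleton, the realised domain and the occupied set of
  `gmap f G` read with the primed data equal those of `G` (no injectivity needed: they are unions over the events);
* §2 the realised-data predicate: `skelOK_gmap : SkelOK q step piece fat dC G → SkelOK q step' piece' fat' dC (gmap f G)`;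
* §3 counts: `treeSteps_gmap`, `Dfun_gmap`, `treeD_gmap`, `treeCells_gmap` (equalities).
USE (next file `SpaceTimeRealisedLin`): with `f := Prod.mk λ`, `step' := PEv.step ∘ Prod.snd`,
`piece' (λ, e) := pieceOf L s (P λ) e`, the realised histories `P λ` of the COUNT carrier (one piece map EACH,
`SpaceTimeJunction.pieceOf`) become the lineages of ONE `LinData` over the labels `Λ × PEv`, while the readings
(consistency, banked factor, cell clause) stay stated on the canonical labels `(P λ).toGen : Gen PEv`.

HONEST DEPENDENCY (cell, verbatim): continuum YM on T⁴ ⇐ BetaPertH ∧ nine spine estimates (0/9 proved); BetaPertH ⇐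
(D1) ∧ (D4) ∧ CAP+tail; G-an2-4 gates asym, D1 and NE2/3/4.  This file changes none of it.
-/

open Finset

namespace Summit.QuantumFields.BalabanUV.T4Continuum.SpaceTimePeierls

open Literature.MathematicalPhysics.QuantumFieldTheory.Balaban1983to89
open Literature.MathematicalPhysics.QuantumFieldTheory.Balaban1983to89.B13ScaleTransfer
open Literature.MathematicalPhysics.QuantumFieldTheory.Balaban1983to89.TreeLength
open Literature.MathematicalPhysics.QuantumFieldTheory.Balaban1983to89.B16SProfile
open T4PersistenceDictionary
open Summit.QuantumFields.BalabanUV.T4Continuum.ZoneSkeleton (gmap events_gmap)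

noncomputable section

variable {d : ℕ} {ε δ : Type*} [DecidableEq ε] [DecidableEq δ] (f : ε → δ)
variable {q : ℕ → ℕ} {step : ε → ℕ} {step' : δ → ℕ} {piece : ε → Finset (Pt d)} {piece' : δ → Finset (Pt d)}
  {fat : ε → ℕ} {fat' : δ → ℕ} {dC : ℝ}

/-! ## §1 Skeleton, realised domain and occupied set are invariant -/

/-- events of a push-forward are hit by the map: membership form [folklore] -/
theorem mem_events_gmap {G : Gen ε} {e' : δ} (h : e' ∈ (gmap f G).events) : ∃ e ∈ G.events, f e = e' := by
  rw [events_gmap, mem_image] at h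
  exact h

/-- **THE SKELETON IS INVARIANT**: `skel q step' piece' (gmap f G) n = skel q step piece G n`. [folklore] -/
theorem skel_gmap (hstep : ∀ e, step' (f e) = step e) (hpiece : ∀ e, piece' (f e) = piece e) (G : Gen ε) (n : ℕ) :
    skel q step' piece' (gmap f G) n = skel q step piece G n := by
  simp only [skel, events_gmap, image_biUnion, hstep, hpiece]

/-- **THE REALISED DOMAIN IS INVARIANT**: `dom q step' piece' (gmap f G) n = dom q step piece G n`. [folklore] -/
theorem dom_gmap (hstep : ∀ e, step' (f e) = step e) (hpiece : ∀ e, piece' (f e) = piece e) (G : Gen ε) (n : ℕ) :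
    dom q step' piece' (gmap f G) n = dom q step piece G n := by
  simp only [dom, events_gmap, image_biUnion, hstep, hpiece]

/-- **THE OCCUPIED SET IS INVARIANT**: `occAt q step' piece' (gmap f G) u = occAt q step piece G u`. [folklore] -/
theorem occAt_gmap (hstep : ∀ e, step' (f e) = step e) (hpiece : ∀ e, piece' (f e) = piece e) :
    ∀ (G : Gen ε) (u : ℕ), occAt q step' piece' (gmap f G) u = occAt q step piece G u
  | Gen.born b j, u => by
      have hd := dom_gmap f (q := q) hstep hpiece (Gen.born b j) u
      simp only [gmap] at hd ⊢
      simp only [occAt, hd]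
  | Gen.renew G e h, u => by
      have hd := dom_gmap f (q := q) hstep hpiece (Gen.renew G e h) u
      have ih := occAt_gmap hstep hpiece G u
      simp only [gmap] at hd ⊢
      simp only [occAt, hd, ih]
  | Gen.merge X Y e, u => by
      have hd := dom_gmap f (q := q) hstep hpiece (Gen.merge X Y e) u
      have ihX := occAt_gmap hstep hpiece X u
      have ihY := occAt_gmap hstep hpiece Y u
      simp only [gmap] at hd ⊢
      simp only [occAt, hd, ihX, ihY, hstep]

/-! ## §2 The realised-data predicate transports -/

/-- **`SkelOK` TRANSPORTS ALONG THE PUSH-FORWARD**: a realised lineage read with `(step, piece, fat)` is a realised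
lineage after relabelling, read with any `(step', piece', fat')` that agree with them along `f`. [folklore] -/
theorem skelOK_gmap (hstep : ∀ e, step' (f e) = step e) (hpiece : ∀ e, piece' (f e) = piece e)
    (hfat : ∀ e, fat' (f e) = fat e) :
    ∀ {G : Gen ε}, SkelOK q step piece fat dC G → SkelOK q step' piece' fat' dC (gmap f G)
  | Gen.born b j, hok => by
      obtain ⟨h1, h2, h3, h4⟩ := hok
      simp only [gmap, SkelOK, hstep, hpiece, hfat]
      exact ⟨h1, h2, h3, h4⟩
  | Gen.renew G e h, hok => by
      obtain ⟨h1, h2, h3, h4⟩ := hok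
      simp only [gmap, SkelOK]
      refine ⟨skelOK_gmap hstep hpiece hfat h1, by rw [hpiece]; exact h2, by rw [hstep]; exact h3, ?_⟩
      intro e' he'
      obtain ⟨e₀, he₀, rfl⟩ := mem_events_gmap f he'
      rw [hstep]
      exact h4 e₀ he₀
  | Gen.merge X Y e, hok => by
      obtain ⟨hX, hY, hcX, hcY, hconn, hpc, hlen⟩ := hok
      have hs := skel_gmap f (q := q) hstep hpiece (Gen.merge X Y e) (step e)
      simp only [gmap] at hs ⊢
      simp only [SkelOK]
      refine ⟨skelOK_gmap hstep hpiece hfat hX, skelOK_gmap hstep hpiece hfat hY, ?_, ?_, ?_, ?_, ?_⟩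
      · intro e' he'
        obtain ⟨e₀, he₀, rfl⟩ := mem_events_gmap f he'
        rw [hstep, hstep]
        exact hcX e₀ he₀
      · intro e' he'
        obtain ⟨e₀, he₀, rfl⟩ := mem_events_gmap f he'
        rw [hstep, hstep]
        exact hcY e₀ he₀
      · rw [hstep, hs]
        exact hconn
      · rw [hpiece]
        exact hpc
      · rw [hpiece]
        exact hlen

/-! ## §3 The counts are invariant -/

omit [DecidableEq ε] [DecidableEq δ] in
/-- **THE STRUCTURE-STEP COUNT IS INVARIANT**: `treeSteps step' (gmap f G) t = treeSteps step G t`. [folklore] -/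
theorem treeSteps_gmap (hstep : ∀ e, step' (f e) = step e) :
    ∀ (G : Gen ε) (t : ℕ), treeSteps step' (gmap f G) t = treeSteps step G t
  | Gen.born b j, t => by simp only [gmap, treeSteps]
  | Gen.renew G e h, t => by
      have ih := treeSteps_gmap hstep G (min (h + 1) t)
      simp only [gmap] at ih ⊢
      simp only [treeSteps, ih]
  | Gen.merge X Y e, t => by
      have ihX := treeSteps_gmap hstep X (min (step e) t)
      have ihY := treeSteps_gmap hstep Y (min (step e) t)
      simp only [gmap] at ihX ihY ⊢
      simp only [treeSteps, hstep, ihX, ihY]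

omit [DecidableEq ε] [DecidableEq δ] in
/-- **THE MODELLED PROFILE IS INVARIANT**: `Dfun fat' step' dC (gmap f G) n = Dfun fat step dC G n`. [folklore] -/
theorem Dfun_gmap (hstep : ∀ e, step' (f e) = step e) (hfat : ∀ e, fat' (f e) = fat e) :
    ∀ (G : Gen ε) (n : ℕ), Dfun fat' step' dC (gmap f G) n = Dfun fat step dC G n
  | Gen.born b j, n => by simp only [gmap, Dfun, hfat]
  | Gen.renew G e h, n => by
      have ih := Dfun_gmap hstep hfat G n
      simp only [gmap] at ih ⊢
      simp only [Dfun, ih]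
  | Gen.merge X Y e, n => by
      have ihX := Dfun_gmap hstep hfat X n
      have ihY := Dfun_gmap hstep hfat Y n
      simp only [gmap] at ihX ihY ⊢
      simp only [Dfun, ihX, ihY, hstep]

omit [DecidableEq ε] [DecidableEq δ] in
/-- **THE TREE SUM OF THE PROFILE IS INVARIANT**: `treeD fat' step' dC (gmap f G) t = treeD fat step dC G t`. [folklore] -/
theorem treeD_gmap (hstep : ∀ e, step' (f e) = step e) (hfat : ∀ e, fat' (f e) = fat e) :
    ∀ (G : Gen ε) (t : ℕ), treeD fat' step' dC (gmap f G) t = treeD fat step dC G t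
  | Gen.born b j, t => by
      have hD := Dfun_gmap f (dC := dC) hstep hfat (Gen.born b j)
      simp only [gmap] at hD ⊢
      simp only [treeD, hD]
  | Gen.renew G e h, t => by
      have ih := treeD_gmap hstep hfat G (min (h + 1) t)
      have hD := Dfun_gmap f (dC := dC) hstep hfat (Gen.renew G e h)
      simp only [gmap] at ih hD ⊢
      simp only [treeD, ih, hD]
  | Gen.merge X Y e, t => by
      have ihX := treeD_gmap hstep hfat X (min (step e) t)
      have ihY := treeD_gmap hstep hfat Y (min (step e) t)
      have hD := Dfun_gmap f (dC := dC) hstep hfat (Gen.merge X Y e)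
      simp only [gmap] at ihX ihY hD ⊢
      simp only [treeD, hstep, ihX, ihY, hD]

/-- **THE TREE CELL COUNT IS INVARIANT**: `treeCells q step' piece' (gmap f G) t = treeCells q step piece G t`.
[folklore] -/
theorem treeCells_gmap (hstep : ∀ e, step' (f e) = step e) (hpiece : ∀ e, piece' (f e) = piece e) :
    ∀ (G : Gen ε) (t : ℕ), treeCells q step' piece' (gmap f G) t = treeCells q step piece G t
  | Gen.born b j, t => by
      have hD := dom_gmap f (q := q) hstep hpiece (Gen.born b j)
      simp only [gmap] at hD ⊢
      simp only [treeCells, hD]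
  | Gen.renew G e h, t => by
      have ih := treeCells_gmap hstep hpiece G (min (h + 1) t)
      have hD := dom_gmap f (q := q) hstep hpiece (Gen.renew G e h)
      simp only [gmap] at ih hD ⊢
      simp only [treeCells, ih, hD]
  | Gen.merge X Y e, t => by
      have ihX := treeCells_gmap hstep hpiece X (min (step e) t)
      have ihY := treeCells_gmap hstep hpiece Y (min (step e) t)
      have hD := dom_gmap f (q := q) hstep hpiece (Gen.merge X Y e)
      simp only [gmap] at ihX ihY hD ⊢
      simp only [treeCells, hstep, ihX, ihY, hD]

end

end Summit.QuantumFields.BalabanUV.T4Continuum.SpaceTimePeierls
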